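import Literature.MathematicalPhysics.KineticTheory.LangevinChainConfined
import Literature.Barriers.AtomisticToContinuum.StrongPinningBreathersLyapunov
import Mathlib.Analysis.InnerProductSpace.NormPow
import HarnessLib

/-!
# The Hairer–Mattingly chain: its Langevin transition semigroup (global solutions, Markov, Feller, Dynkin)

`Literature/Barriers/AtomisticToContinuum/` (D-0021 barrier catalogue), companion of
`StrongPinningBreathers.lean` (barrier fact `HairerMattingly2009_threeOscillators`) and
`StrongPinningBreathersLyapunov.lean`. Hairer–Mattingly 2009 prove existence of the invariant
measure of the three-oscillator chain by Prop. 5.1 — "Consider a SDE on `ℝⁿ` with smooth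
coefficients having global solutions and generator `L`" — applied to the chain `e:threeosc` of §2
with the Lyapunov function of Thm 5.6. This file supplies the object that sentence presupposes, for
the chain `homogeneouslyPinnedChain k γ` (`U(q) = |q|^{2k}/2k`, `V(r) = r²/2`, friction `γ`) with
`k > 3/2`, `γ ≥ 0`, ANY number `N ≥ 1` of sites and bath temperatures `T_L, T_R ≥ 0`:

* `homogeneouslyPinnedChain_contDiff_two_U` — `|q|^{2k}/2k ∈ C²` for `k > 3/2`
  (`U'(q) = |q|^{2k-2} q`, `homogeneouslyPinnedChain_deriv_U`);
* `homogeneouslyPinnedChain_isConfining` — the chain satisfies the hypothesis structure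
  `OscillatorChain.IsConfining` of `LangevinChainConfined.lean` (`|U'| = |q|^{2k-1} ≤ 2k(1 + U)`,
  `|V'| = |r| ≤ 1 + V`, `U → ∞`);
* `homogeneouslyPinnedChainSemigroup` — hence the transition kernels of its Langevin SDE form a
  `LangevinChainSemigroup (homogeneouslyPinnedChain k γ) N T_L T_R` (global solutions = Markov
  kernels, Chapman–Kolmogorov, measurability, Dynkin's identity for the generator
  `OscillatorChain.generator`), which is moreover Feller
  (`continuous_act_homogeneouslyPinnedChainSemigroup`) and satisfies Dynkin's identity already on
  `C²_c` (`homogeneouslyPinnedChainSemigroup_dynkin_two`).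

This closes node N1 ("the SDE transition semigroup of the `|q|^{2k}`-pinned chain") of the
discharge programme for `HairerMattingly2009_threeOscillators` recorded in the provefact unit's
notes; the remaining inputs of the printed proof are Thm 5.6 (the averaging Lyapunov function) and
the uniqueness argument of §1 (hypoellipticity and control). No named fact is introduced here.

## References

* M. Hairer, J. C. Mattingly, Comm. Pure Appl. Math. **62** (2009) 999–1032 (arXiv:0712.3884),
  §2 (the three-oscillator model), §3.1 ("`k` not necessarily an integer, so `H_f` is only
  `C^{[2k]}`"), Prop. 5.1.
-/

noncomputable section

open MeasureTheory Filter Topology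
open scoped NNReal

namespace Literature.Barriers.AtomisticToContinuum.HeatConduction

open Literature.MathematicalPhysics.KineticTheory.HeatConduction

/-! ### `|q|^{2k}/2k` is `C²` for `k > 3/2` -/

/-- `U'(q) = |q|^{2k-2} q` for the homogeneous pinning `U = |q|^{2k}/2k` (`2k > 1`).
[cite: HairerMattingly2009, §2] -/
theorem homogeneouslyPinnedChain_hasDerivAt_U {k : ℝ} (hk : 1 < 2 * k) (γ q : ℝ) :
    HasDerivAt (homogeneouslyPinnedChain k γ).U (|q| ^ (2 * k - 2) * q) q := by
  have hU : (homogeneouslyPinnedChain k γ).U = fun x => |x| ^ (2 * k) / (2 * k) := rfl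
  have h := (hasDerivAt_abs_rpow q hk).div_const (2 * k)
  rw [hU]
  have hk0 : k ≠ 0 := by
    intro h0
    rw [h0] at hk
    norm_num at hk
  refine h.congr_deriv ?_
  field_simp

/-- `deriv U = fun q => |q|^{2k-2} q` (`2k > 1`). [cite: HairerMattingly2009, §2] -/
theorem homogeneouslyPinnedChain_deriv_U {k : ℝ} (hk : 1 < 2 * k) (γ : ℝ) :
    deriv (homogeneouslyPinnedChain k γ).U = fun q => |q| ^ (2 * k - 2) * q :=
  funext fun q => (homogeneouslyPinnedChain_hasDerivAt_U hk γ q).deriv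

/-- `|U'(q)| = |q|^{2k-1}` (`2k > 1`). [cite: HairerMattingly2009, §2] -/
theorem homogeneouslyPinnedChain_abs_deriv_U {k : ℝ} (hk : 1 < 2 * k) (γ q : ℝ) :
    |deriv (homogeneouslyPinnedChain k γ).U q| = |q| ^ (2 * k - 1) := by
  rw [homogeneouslyPinnedChain_deriv_U hk γ]
  dsimp only
  rw [abs_mul, abs_of_nonneg (Real.rpow_nonneg (abs_nonneg q) _),
    show 2 * k - 1 = (2 * k - 2) + 1 by ring, Real.rpow_add_one' (abs_nonneg q) (by linarith)]

/-- **`U = |q|^{2k}/2k` is `C²` for `k > 3/2`**: `U' = |q|^{2k-2}·q` with `|q|^{2k-2} ∈ C¹` since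
`2k - 2 > 1` (`contDiff_norm_rpow`). (HM §3.1: `H_f ∈ C^{[2k]}`.) [cite: HairerMattingly2009, §3.1] -/
theorem homogeneouslyPinnedChain_contDiff_two_U {k : ℝ} (hk : 3 / 2 < k) (γ : ℝ) :
    ContDiff ℝ 2 (homogeneouslyPinnedChain k γ).U := by
  have hk1 : 1 < 2 * k := by linarith
  rw [show (2 : WithTop ℕ∞) = 1 + 1 by norm_num, contDiff_succ_iff_deriv]
  refine ⟨fun q => (homogeneouslyPinnedChain_hasDerivAt_U hk1 γ q).differentiableAt,
    fun h => absurd h (by simp), ?_⟩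
  rw [homogeneouslyPinnedChain_deriv_U hk1 γ]
  have h1 : ContDiff ℝ 1 (fun q : ℝ => ‖q‖ ^ (2 * k - 2)) := contDiff_norm_rpow (by linarith)
  simp only [Real.norm_eq_abs] at h1
  exact h1.mul contDiff_id

/-- `U = |q|^{2k}/2k → ∞` as `|q| → ∞` (`k > 0`). [folklore] -/
theorem homogeneouslyPinnedChain_tendsto_U {k : ℝ} (hk : 0 < k) (γ : ℝ) :
    Tendsto (homogeneouslyPinnedChain k γ).U (cocompact ℝ) atTop := by
  have hU : (homogeneouslyPinnedChain k γ).U = fun x => ‖x‖ ^ (2 * k) / (2 * k) := by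
    funext x
    simp only [homogeneouslyPinnedChain, Real.norm_eq_abs]
  rw [hU]
  exact ((tendsto_rpow_atTop (by positivity : 0 < 2 * k)).comp
    tendsto_norm_cocompact_atTop).atTop_div_const (by positivity)

/-! ### The Hairer–Mattingly chain has confining potentials -/

/-- **The Hairer–Mattingly chain satisfies `OscillatorChain.IsConfining`** for `k > 3/2`, `γ ≥ 0`:
`U, V ∈ C²` and nonnegative, `|U'(q)| = |q|^{2k-1} ≤ 1 + |q|^{2k} ≤ 2k (1 + U(q))`,
`|V'(r)| = |r| ≤ 1 + r²/2`, `U(q) → ∞`. [cite: HairerMattingly2009, §2] -/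
theorem homogeneouslyPinnedChain_isConfining {k : ℝ} (hk : 3 / 2 < k) {γ : ℝ} (hγ : 0 ≤ γ) :
    (homogeneouslyPinnedChain k γ).IsConfining where
  contDiff_U := homogeneouslyPinnedChain_contDiff_two_U hk γ
  contDiff_V := homogeneouslyPinnedChain_contDiff_V k γ
  γ_nonneg := hγ
  U_nonneg q := by
    show 0 ≤ |q| ^ (2 * k) / (2 * k)
    exact div_nonneg (Real.rpow_nonneg (abs_nonneg q) _) (by linarith)
  V_nonneg r := by
    show 0 ≤ r ^ 2 / 2
    positivity
  exists_abs_deriv_U_le := by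
    have hk1 : 1 < 2 * k := by linarith
    refine ⟨2 * k, by linarith, fun q => ?_⟩
    rw [homogeneouslyPinnedChain_abs_deriv_U hk1 γ q]
    show |q| ^ (2 * k - 1) ≤ 2 * k * (1 + |q| ^ (2 * k) / (2 * k))
    have hq0 : 0 ≤ |q| ^ (2 * k) := Real.rpow_nonneg (abs_nonneg q) _
    have h1 : |q| ^ (2 * k - 1) ≤ 1 + |q| ^ (2 * k) := by
      rcases le_or_gt |q| 1 with h | h
      · have : |q| ^ (2 * k - 1) ≤ 1 := Real.rpow_le_one (abs_nonneg q) h (by linarith)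
        linarith
      · have : |q| ^ (2 * k - 1) ≤ |q| ^ (2 * k) :=
          Real.rpow_le_rpow_of_exponent_le h.le (by linarith)
        linarith
    have h2 : 2 * k * (1 + |q| ^ (2 * k) / (2 * k)) = 2 * k + |q| ^ (2 * k) := by
      field_simp
    rw [h2]
    linarith
  exists_abs_deriv_V_le := by
    refine ⟨1, zero_le_one, fun r => ?_⟩
    have hV : (homogeneouslyPinnedChain k γ).V = fun x => x ^ 2 / 2 := rfl
    have hd : deriv (homogeneouslyPinnedChain k γ).V r = r := by
      rw [hV]
      have h : HasDerivAt (fun x : ℝ => x ^ 2 / 2) (2 * r ^ 1 * 1 / 2) r :=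
        ((hasDerivAt_id r).pow 2).div_const 2
      rw [h.deriv]
      ring
    rw [hd]
    show |r| ≤ 1 * (1 + r ^ 2 / 2)
    have := abs_le_half_add_sq_half r
    linarith
  tendsto_U := homogeneouslyPinnedChain_tendsto_U (by linarith) γ

/-! ### The transition semigroup of the Hairer–Mattingly chain -/

variable {k γ : ℝ} {N : ℕ} {T_L T_R : ℝ}

/-- **The Langevin transition semigroup of the Hairer–Mattingly chain** (`k > 3/2`, `γ ≥ 0`,
`N ≥ 1` sites, `T_L, T_R ≥ 0`): the transition kernels `P_t(x, ·) = law(Φ_t(x, B))` of the SDE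
`dq = p dt`, `dp_i = (-∂_{q_i}H - γ1_B p_i) dt + √(2γT_b) dB^b` (global pathwise solutions) form a
`LangevinChainSemigroup` — Markov kernels, `P_0 = id`, Chapman–Kolmogorov, jointly measurable,
Dynkin's identity on `C_c^∞` for the generator `L` of the chain. This is "a SDE on `ℝⁿ` … having
global solutions and generator `L`" of HM Prop. 5.1 for the model of §2 (there `N = 3`, HM's
"chain of length three"); the coefficients are `C¹`, not smooth, for non-integer `k` (§3.1).
[cite: HairerMattingly2009, Prop 5.1 and §2] -/
def homogeneouslyPinnedChainSemigroup (hk : 3 / 2 < k) (hγ : 0 ≤ γ) (hN : 0 < N) (hTL : 0 ≤ T_L)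
    (hTR : 0 ≤ T_R) : LangevinChainSemigroup (homogeneouslyPinnedChain k γ) N T_L T_R :=
  (homogeneouslyPinnedChain_isConfining hk hγ).semigroup N T_L T_R hN hTL hTR

/-- The kernels of the Hairer–Mattingly semigroup are the `langevinKernel`s of the chain. [folklore] -/
@[simp] theorem homogeneouslyPinnedChainSemigroup_kernel (hk : 3 / 2 < k) (hγ : 0 ≤ γ) (hN : 0 < N)
    (hTL : 0 ≤ T_L) (hTR : 0 ≤ T_R) (t : ℝ≥0) :
    (homogeneouslyPinnedChainSemigroup hk hγ hN hTL hTR).kernel t =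
      (homogeneouslyPinnedChain k γ).langevinKernel N T_L T_R t := rfl

/-- **The Feller property** of the Hairer–Mattingly semigroup: `x ↦ P^t g(x)` is continuous for
bounded continuous `g` (the hypothesis "Feller" of HM Prop. 5.1). [cite: HairerMattingly2009, Prop 5.1] -/
theorem continuous_act_homogeneouslyPinnedChainSemigroup (hk : 3 / 2 < k) (hγ : 0 ≤ γ) (hN : 0 < N)
    (hTL : 0 ≤ T_L) (hTR : 0 ≤ T_R) (t : ℝ≥0) (g : BoundedContinuousFunction (PhaseSpace N) ℝ) :
    Continuous ((homogeneouslyPinnedChainSemigroup hk hγ hN hTL hTR).act t g) :=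
  (homogeneouslyPinnedChain_isConfining hk hγ).continuous_act_semigroup N T_L T_R hN hTL hTR t g

/-- **Dynkin's identity on `C²_c`** for the Hairer–Mattingly semigroup:
`P_t f(z) - f(z) = ∫₀ᵗ P_s(Lf)(z) ds` (the identity behind "applying Itô's formula to `𝒱`" in the
proof of HM Prop. 5.1, here for compactly supported `C²` test functions).
[cite: HairerMattingly2009, Prop 5.1 (proof)] -/
theorem homogeneouslyPinnedChainSemigroup_dynkin_two (hk : 3 / 2 < k) (hγ : 0 ≤ γ) (hN : 0 < N)
    (hTL : 0 ≤ T_L) (hTR : 0 ≤ T_R) {f : PhaseSpace N → ℝ} (hf : ContDiff ℝ 2 f)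
    (hf' : HasCompactSupport f) (t : ℝ≥0) (z : PhaseSpace N) :
    (homogeneouslyPinnedChainSemigroup hk hγ hN hTL hTR).act t f z - f z =
      ∫ s in (0 : ℝ)..(t : ℝ), (homogeneouslyPinnedChainSemigroup hk hγ hN hTL hTR).act s.toNNReal
        ((homogeneouslyPinnedChain k γ).generator N T_L T_R f) z :=
  (homogeneouslyPinnedChain_isConfining hk hγ).semigroup_dynkin_two N T_L T_R hN hTL hTR hf hf' t z

/-- In particular, for the THREE-oscillator chain of HM §2 with `k > 3/2`, `γ > 0`, `T_L, T_R > 0`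
(the hypotheses of `HairerMattingly2009_threeOscillators`) the semigroup exists; what the fact
asserts beyond this is that it has exactly one invariant probability measure.
[cite: HairerMattingly2009, Abstract and Prop 5.1] -/
theorem exists_langevinChainSemigroup_three (hk : 3 / 2 < k) (hγ : 0 < γ) (hTL : 0 < T_L)
    (hTR : 0 < T_R) :
    ∃ S : LangevinChainSemigroup (homogeneouslyPinnedChain k γ) 3 T_L T_R,
      ∀ t : ℝ≥0, S.kernel t = (homogeneouslyPinnedChain k γ).langevinKernel 3 T_L T_R t :=
  ⟨homogeneouslyPinnedChainSemigroup hk hγ.le (by norm_num) hTL.le hTR.le, fun _ => rfl⟩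

end Literature.Barriers.AtomisticToContinuum.HeatConduction

end
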